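import Summits.PneNP.PneNP.Theses.CnfIdealGenLength

/-!
# Route `CnfIdealGenLength` — the assembly item (stmt-PneNP-18887)

The assembly `GenLengthSuperpoly → FregeShortensGenLength → CollapseReachesFrege → PneNP` is, by
definition, the route's deciding theorem `closes`; this file records it as a theorem whose type is
literally the route declaration `Assembly` (bookkeeping item; candidate proof attached to the item by
refuter-ns-typeII-critic-2-g9, landed here).  Nothing here bears on P vs NP beyond the route's own glue.
-/

set_option linter.dupNamespace false -- `Summit.PneNP.PneNP.…`: summit = sub-problem name (D-0017)

namespace Summit.PneNP.PneNP.Theorems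

/-- The assembly of route `CnfIdealGenLength`: the three route statements imply `PneNP`, by the route's
deciding theorem `Summit.PneNP.PneNP.Theses.CnfIdealGenLength.closes`. -/
theorem cnfIdealGenLength_assembly_proof :
    Summit.PneNP.PneNP.Theses.CnfIdealGenLength.Assembly :=
  fun hGL hSh hC => Summit.PneNP.PneNP.Theses.CnfIdealGenLength.closes hGL hSh hC

end Summit.PneNP.PneNP.Theorems
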